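import Summits.AtomisticToContinuum.FouriersLaw.Theses.FeketeSeriesLaw
import Summits.AtomisticToContinuum.FouriersLaw.Theses.JunctionLocality
import Summits.AtomisticToContinuum.FouriersLaw.Theorems.OddSectorIrreversibilityBoundedResponseConvergesStubPositiveConductance

/-!
# Birth skeleton of crux `FeketeSeriesLaw.BoundedResponse` (stmt-AtomisticToContinuum-11071)
# — line `birth`: SUPERADDITIVE JUNCTION + NOT BALLISTIC ⇒ BOUNDED RESPONSE

Crux (route `route-AtomisticToContinuum-FeketeSeriesLaw`, rank 3; the shared necessary waypoint, also wanted by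
BondHeatUncertainty / PhononMeanFreePath / PhononLorentzGas as a support item):

  `BoundedResponse` — for `pinnedChain ω₂ lam β γ` (all four `> 0`), along EVERY steady-state family `μ` and
  every `T > 0`, if the finite-`N` response limits `D_N = lim_{δ→0, δ≠0} totalCurrent(μ N (T+δ/2) (T−δ/2))/δ`
  exist for all `N`, then `(|D_N|)_N` is bounded.

## The line (resistance language, the mirror image of the route's own crux (S) `QuasiSubadditiveResistance`)

Write `R_N := (N−1)/D_N` (bath-to-bath thermal resistance; a resistance because `D_N > 0` for `N ≥ 2`,
LANDED: `TwoScaleGluingLogRigidity.Stubs.positiveConductance_holds` = route item `FeketeSeriesLaw.PositiveConductance`,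
stmt-11750) and use weak-NESS uniqueness (LANDED: `FeketeSeriesLaw.NessUnique_holds`, stmt-0741) to put every
steady-state family in the uniqueness regime. Then `BoundedResponse` (⇔ `R_N ≥ (N−1)/S`, resistance grows at
least linearly) follows from TWO stubs:

* `stub_superadditiveResistance` (A): `∃ C ∀ N, M ≥ 2, R_{N+M} ≥ R_N + R_M − C` — SUPERADDITIVE JUNCTION LOCALITY:
  cutting an `(N+M)`-chain into two bathed halves (re-thermalising the cut) raises the end-to-end resistance by at
  most a contact constant. VERBATIM the open crux `JunctionLocality.SuperadditiveResistance` (stmt-11748, rank 2 of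
  route JunctionLocality; `stub_superadditiveResistance_iff` below is `Iff.rfl`), so one proof closes both.
* `stub_nonBallistic` (B): `∀ ε > 0 ∀ N₀ ∃ N ≥ N₀, D_N ≤ ε (N−1)` — the conductance `G_N = D_N/(N−1)` is not bounded
  away from `0` (NOT BALLISTIC). VERBATIM the shared open item `NonBallistic` (stmt-9127: crux rank 3 of
  JunctionLocality, support of BondHeatUncertainty where the LANDED glue `transferToNonBallistic_proof` derives it
  from `LightConeBondHeat`, stmt-9123; `stub_nonBallistic_iff` below is `Iff.rfl`). NECESSARY for the conjunct
  (`FouriersLaw ⇒ D_N → κ < ∞ ⇒ D_N ≤ ε(N−1)` eventually) and implied by the crux itself, but much weaker than it: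
  a `liminf`, not a `sup`.

COMPOSITION (sorry-free, `BoundedResponse_of`, pure real analysis `bddAbove_abs_of_superadditive_nonBallistic`):
`a_N := R_N − C` is superadditive on the index semigroup `{N ≥ 2}`; (B) at `ε := 1/(|C|+1)` gives ONE length
`n₀ ≥ 2` with `a_{n₀} ≥ 1`; superadditivity along `q·n₀ + r` (`r ∈ [n₀, 2n₀)`, finitely many offsets) gives the
LINEAR lower bound `a_N ≥ (a_{n₀}/n₀)·N − 2a_{n₀} + L`, hence `R_N ≥ c₁N/2` and `0 < D_N ≤ 2/c₁` for all large
`N`; finitely many small `N` are absorbed (`IsBoundedUnder.bddAbove_range`). So: a sign (superadditivity) plus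
ONE finite-size certificate (`R_{n₀} > C`) give bounded response — the finite-size-criterion mechanism of
percolation / subadditive ergodic theory (Hammersley1988; ArmstrongKuusiMourrat2019 Ch. 1–2), here fed by (B).

Calibration / honesty: at the harmonic corner `lam = β = 0` (excluded by the hypotheses) `R_N = 1/c_N` is bounded,
so (A) HOLDS and (B) FAILS (`HarmonicChainBallisticFlux`, `JunctionLocality.HarmonicCalibration`): the line cannot
prove too much, and all anharmonic content sits in (B) (light-cone / bond-heat engines) and in the `N`-uniformity
of the junction constant in (A) (Dirichlet–Thomson gluing for `L = A_H + γS`, reservoir-insertion cost).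
Neither stub is cheaply the crux or the summit (BC3 probes `stub → BoundedResponse`, `stub → FouriersLaw` by
`first | exact? | simpa | aesop` all FAIL — planner folder `bc/*_probe.lean`): (A) alone is consistent with
`κ = ∞` (harmonic corner: bounded `R_N`), (B) alone with unbounded response (`D_N` small along one subsequence and
unbounded along another).

Alternative landed line (not re-registered here): `Theorems.transferToBoundedResponse_proof` (stmt-9655) gives the
twin `BondHeatUncertainty.BoundedResponse` from `SubdiffusiveBondHeat` (9120) + `ExtensiveSnapshotIrreversibility`
(9121) + the LANDED `LinearResponseFTUR_proof` + `NessUnique`; those two cruxes are staffed on route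
BondHeatUncertainty.

Disproof used: none on file for this crux (`ledger crux ls stmt-AtomisticToContinuum-11071`: no Disproof.lean);
negatives index: no FouriersLaw statement among the refuted items bears on (A)/(B) (both are OPEN items 11748 / 9127).

Registered stubs (2): `stub_superadditiveResistance`, `stub_nonBallistic` — each a sorried theorem
`Holds.stub_<name> : <full statement over tree declarations> := by sorry` (registered by `ledger skeleton check`
under the short name with THAT text as signature) plus the by-name handle `def stub_<name> : Prop := type_of% …`
required of the hypotheses of `BoundedResponse_of` by the layer-invariant audit (`#h21_check_skeleton`).
Skeleton theorem: `BoundedResponse_of : stub_superadditiveResistance → stub_nonBallistic →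
FeketeSeriesLaw.BoundedResponse` (sorry-free; axioms propext / Classical.choice / Quot.sound). The twins for the
three other wanting routes (`BondHeatUncertainty` / `PhononMeanFreePath` / `PhononLorentzGas` `.BoundedResponse`,
identical text, one shared item) follow definitionally from `BoundedResponse_of`; they are not rendered here so
that the import cone stays at the two Theses files actually used.
-/

noncomputable section

namespace Summit.AtomisticToContinuum.FouriersLaw.Cruxes.BoundedResponse.Birth

open Filter Topology

/-! ## Part I — the glue, proved (pure real analysis) -/

namespace Glue

/-- **Superadditive junction + one non-ballistic length ⇒ bounded response.** If `D_N > 0` (`N ≥ 2`), the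
resistances `R_N := (N−1)/D_N` satisfy `R_N + R_M − C ≤ R_{N+M}` (`N, M ≥ 2`) and `D_N ≤ ε(N−1)` happens for
every `ε > 0` beyond every `N₀`, then `(|D_N|)_N` is bounded. Proof: `a_N := R_N − C` is superadditive on
`{N ≥ 2}`; `ε = 1/(|C|+1)` yields `n₀ ≥ 2` with `a_{n₀} ≥ 1`; induction along `q·n₀ + r` with `r ∈ [n₀, 2n₀)`
gives `a_N ≥ (a_{n₀}/n₀)N − 2a_{n₀} + L`, so eventually `R_N ≥ c₁N/2` and `0 < D_N ≤ 2/c₁`.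
[folklore; cf. Hammersley1988 (Fekete-type finite-size criteria)] -/
theorem bddAbove_abs_of_superadditive_nonBallistic {D : ℕ → ℝ} {C : ℝ}
    (hpos : ∀ N : ℕ, 2 ≤ N → 0 < D N)
    (hsup : ∀ N M : ℕ, 2 ≤ N → 2 ≤ M →
      ((N : ℝ) - 1) / D N + ((M : ℝ) - 1) / D M - C ≤ ((N : ℝ) + (M : ℝ) - 1) / D (N + M))
    (hnb : ∀ ε : ℝ, 0 < ε → ∀ N₀ : ℕ, ∃ N : ℕ, N₀ ≤ N ∧ D N ≤ ε * ((N : ℝ) - 1)) :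
    BddAbove (Set.range fun N => |D N|) := by
  -- the defect-corrected resistance `a N = R_N - C` is superadditive on `{N ≥ 2}`
  set a : ℕ → ℝ := fun N => ((N : ℝ) - 1) / D N - C with ha
  have hsa : ∀ n m : ℕ, 2 ≤ n → 2 ≤ m → a n + a m ≤ a (n + m) := by
    intro n m hn hm
    have h := hsup n m hn hm
    simp only [ha, Nat.cast_add]
    linarith
  -- non-ballisticity at `ε = 1/(|C|+1)` gives one length `n₀ ≥ 2` with `a n₀ ≥ 1`
  obtain ⟨n₀, hn₀, hDn₀⟩ := hnb (1 / (|C| + 1)) (by positivity) 2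
  have hDpos₀ : 0 < D n₀ := hpos n₀ hn₀
  have hα : 1 ≤ a n₀ := by
    have hc : 0 < |C| + 1 := by positivity
    have hcne : |C| + 1 ≠ 0 := hc.ne'
    have h1 : |C| + 1 ≤ ((n₀ : ℝ) - 1) / D n₀ := by
      rw [le_div_iff₀ hDpos₀]
      calc (|C| + 1) * D n₀ ≤ (|C| + 1) * (1 / (|C| + 1) * ((n₀ : ℝ) - 1)) :=
            mul_le_mul_of_nonneg_left hDn₀ hc.le
        _ = (n₀ : ℝ) - 1 := by field_simp
    have h2 : C ≤ |C| := le_abs_self C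
    show 1 ≤ ((n₀ : ℝ) - 1) / D n₀ - C
    linarith
  have hαpos : 0 < a n₀ := lt_of_lt_of_le one_pos hα
  -- superadditive growth along the progression `q n₀ + r`
  have hgrow : ∀ q r : ℕ, 2 ≤ r → (q : ℝ) * a n₀ + a r ≤ a (q * n₀ + r) := by
    intro q r hr
    induction q with
    | zero => simp
    | succ q ih =>
      have h2 : 2 ≤ q * n₀ + r := le_add_left hr
      have hs := hsa n₀ (q * n₀ + r) hn₀ h2
      have heq : (q + 1) * n₀ + r = n₀ + (q * n₀ + r) := by ring
      rw [heq]
      have hdist : (((q + 1 : ℕ) : ℝ)) * a n₀ = (q : ℝ) * a n₀ + a n₀ := by push_cast; ring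
      rw [hdist]
      linarith
  -- a lower bound for `a` on the window `[n₀, 2 n₀)` (finitely many offsets)
  obtain ⟨L, hL⟩ : ∃ L : ℝ, ∀ r : ℕ, n₀ ≤ r → r < 2 * n₀ → L ≤ a r := by
    obtain ⟨L, hL⟩ := (Set.finite_range fun i : Fin n₀ => a (n₀ + i)).bddBelow
    refine ⟨L, fun r hr1 hr2 => ?_⟩
    have hi : r - n₀ < n₀ := by omega
    have h := hL (Set.mem_range_self (⟨r - n₀, hi⟩ : Fin n₀))
    have heq : n₀ + (r - n₀) = r := by omega
    have h' : L ≤ a (n₀ + (r - n₀)) := h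
    rwa [heq] at h'
  -- hence the LINEAR lower bound `a N ≥ (a n₀ / n₀) N - 2 a n₀ + L` for `N ≥ n₀`
  have hn₀pos : 0 < n₀ := by omega
  have hn₀real : (0 : ℝ) < n₀ := by exact_mod_cast hn₀pos
  have hn₀ne : (n₀ : ℝ) ≠ 0 := hn₀real.ne'
  have hlin : ∀ N : ℕ, n₀ ≤ N → a n₀ / n₀ * (N : ℝ) - 2 * a n₀ + L ≤ a N := by
    intro N hN
    obtain ⟨q', hq'⟩ : ∃ q' : ℕ, N / n₀ = q' + 1 :=
      ⟨N / n₀ - 1, by have := (Nat.one_le_div_iff hn₀pos).2 hN; omega⟩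
    have hNqr : n₀ * (N / n₀) + N % n₀ = N := Nat.div_add_mod N n₀
    have hr'lt : N % n₀ < n₀ := Nat.mod_lt N hn₀pos
    have hdecomp : q' * n₀ + (N % n₀ + n₀) = N := by
      calc q' * n₀ + (N % n₀ + n₀) = n₀ * (q' + 1) + N % n₀ := by ring
        _ = N := by rw [← hq']; exact hNqr
    have hg := hgrow q' (N % n₀ + n₀) (by omega)
    rw [hdecomp] at hg
    have hLr := hL (N % n₀ + n₀) (by omega) (by omega)
    have hq'real : (N : ℝ) - 2 * n₀ ≤ (q' : ℝ) * n₀ := by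
      have h1 : q' * n₀ + (N % n₀ + n₀) ≤ q' * n₀ + 2 * n₀ := by
        apply Nat.add_le_add_left; omega
      rw [hdecomp] at h1
      have h2 : ((N : ℕ) : ℝ) ≤ ((q' * n₀ + 2 * n₀ : ℕ) : ℝ) := by exact_mod_cast h1
      push_cast at h2
      linarith
    have hstep : a n₀ / n₀ * (N : ℝ) - 2 * a n₀ ≤ (q' : ℝ) * a n₀ := by
      have hrew : a n₀ / n₀ * (N : ℝ) - 2 * a n₀ = a n₀ * (((N : ℝ) - 2 * n₀) / n₀) := by
        field_simp
      rw [hrew]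
      have h3 : ((N : ℝ) - 2 * n₀) / n₀ ≤ (q' : ℝ) := by
        rw [div_le_iff₀ hn₀real]; linarith
      calc a n₀ * (((N : ℝ) - 2 * n₀) / n₀) ≤ a n₀ * q' := mul_le_mul_of_nonneg_left h3 hαpos.le
        _ = (q' : ℝ) * a n₀ := by ring
    linarith
  -- the slope and the offset
  set c₁ : ℝ := a n₀ / n₀ with hc₁
  have hc₁pos : 0 < c₁ := div_pos hαpos hn₀real
  have hc₁ne : c₁ ≠ 0 := hc₁pos.ne'
  set K : ℝ := 2 * a n₀ - L - C with hK
  obtain ⟨N₁, hN₁⟩ := exists_nat_ge (2 * K / c₁)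
  -- eventual bound `|D N| ≤ 2 / c₁`
  have hbound : ∀ N : ℕ, max N₁ n₀ ≤ N → |D N| ≤ 2 / c₁ := by
    intro N hN
    have hNn₀ : n₀ ≤ N := le_trans (le_max_right _ _) hN
    have hNN₁ : N₁ ≤ N := le_trans (le_max_left _ _) hN
    have hN2 : 2 ≤ N := hn₀.trans hNn₀
    have hDN : 0 < D N := hpos N hN2
    have hNreal : (N₁ : ℝ) ≤ N := by exact_mod_cast hNN₁
    have hNpos : (0 : ℝ) < N := by exact_mod_cast (lt_of_lt_of_le (by norm_num) hN2 : 0 < N)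
    have haN : a N = ((N : ℝ) - 1) / D N - C := rfl
    -- `R_N ≥ c₁ N - K ≥ c₁ N / 2`
    have hR : c₁ * (N : ℝ) - K ≤ ((N : ℝ) - 1) / D N := by
      have := hlin N hNn₀
      linarith
    have hKN : 2 * K ≤ c₁ * (N : ℝ) := by
      have h1 : 2 * K / c₁ ≤ N := hN₁.trans hNreal
      have h2 := (div_le_iff₀ hc₁pos).1 h1
      linarith [mul_comm (N : ℝ) c₁]
    have hRpos : c₁ * (N : ℝ) / 2 ≤ ((N : ℝ) - 1) / D N := by linarith
    -- so `D N ≤ 2 (N-1)/(c₁ N) ≤ 2/c₁`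
    have hD_le : D N ≤ 2 / c₁ := by
      have h1 : c₁ * (N : ℝ) / 2 * D N ≤ (N : ℝ) - 1 := (le_div_iff₀ hDN).1 hRpos
      have h2 : c₁ * (N : ℝ) / 2 * D N ≤ c₁ * (N : ℝ) / 2 * (2 / c₁) := by
        have hrew : c₁ * (N : ℝ) / 2 * (2 / c₁) = N := by
          field_simp
        rw [hrew]
        linarith
      exact le_of_mul_le_mul_left h2 (half_pos (mul_pos hc₁pos hNpos))
    rw [abs_of_pos hDN]
    exact hD_le
  have hbu : Filter.IsBoundedUnder (· ≤ ·) Filter.atTop fun N => |D N| :=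
    ⟨2 / c₁, Filter.eventually_atTop.2 ⟨max N₁ n₀, hbound⟩⟩
  exact hbu.bddAbove_range

end Glue

/-! ## Part II — registered stubs (the lemmas of the line; `sorry` only here)

Shape (device of `Cruxes/BoundedResponseConverges/Lines/two_scale_gluing_log_rigidity.lean`): each stub is a
sorried theorem `Holds.stub_<name> : <full statement> := by sorry` — `ledger skeleton check` registers it under the
short name `stub_<name>` with THAT statement text as its signature (self-contained over tree declarations) —
plus the by-name handle `def stub_<name> : Prop := type_of% Holds.stub_<name>` which the layer-invariant audit
(`#h21_check_skeleton`) requires of the hypotheses of `BoundedResponse_of`. -/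

/-- **Stub 1 — SuperadditiveResistance (A): superadditive junction locality (size XL; the load-bearing stub).**
Under weak-NESS uniqueness, for every steady-state family of `pinnedChain ω₂ lam β γ` (all `> 0`), every `T > 0`
and response coefficients `D_N > 0` (`N ≥ 2`): `∃ C` with `R_N + R_M − C ≤ R_{N+M}` for all `N, M ≥ 2`,
`R_N := (N−1)/D_N` — cutting the chain and re-thermalising the cut raises the end-to-end resistance by at most a
contact constant (bounded reservoir-insertion cost, Matthiessen direction). VERBATIM the route item
`JunctionLocality.SuperadditiveResistance` (stmt-AtomisticToContinuum-11748, crux rank 2; `stub_superadditiveResistance_iff`).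
Why plausibly true: holds with room in the ballistic (`R_N` bounded), diffusive (`R_N = N/κ + 2ρ + o(1)`) and
localised (`R_N ~ e^{cN}`) regimes; fails exactly for superdiffusive transport (`R_{2N} = 2^{1−α}R_N`), which
pinning is believed to exclude. Why it might fail: no sign principle (noise on 2 of 2N momenta), repair cost may
grow with `N, M` if optimal response fields carry junction-crossing coherent structure at all scales.
Engines: Dirichlet–Thomson saddle representation of `D_N` for `L = A_H + γS` + junction-repair of admissible pairs
(LandimMarianiSeo2018, GaudilliereLandim2013, arXiv:1105.0493 §6); reservoir insertion through the open-chain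
Kubo formula (KunduDharNarayan2009, ReyBellet2003 Rem. 4.4). -/
theorem Holds.stub_superadditiveResistance :
    ∀ ω₂ lam β γ : ℝ, 0 < ω₂ → 0 < lam → 0 < β → 0 < γ → (∀ (N : ℕ) (T_L T_R : ℝ), 0 < T_L → 0 < T_R → ∀ μ ν : MeasureTheory.Measure (Literature.MathematicalPhysics.KineticTheory.HeatConduction.PhaseSpace N), (Literature.MathematicalPhysics.KineticTheory.HeatConduction.pinnedChain ω₂ lam β γ).IsSteadyState N T_L T_R μ → (Literature.MathematicalPhysics.KineticTheory.HeatConduction.pinnedChain ω₂ lam β γ).IsSteadyState N T_L T_R ν → μ = ν) → ∀ μ : (N : ℕ) → ℝ → ℝ → MeasureTheory.Measure (Literature.MathematicalPhysics.KineticTheory.HeatConduction.PhaseSpace N), (∀ (N : ℕ) (T_L T_R : ℝ), 0 < T_L → 0 < T_R → (Literature.MathematicalPhysics.KineticTheory.HeatConduction.pinnedChain ω₂ lam β γ).IsSteadyState N T_L T_R (μ N T_L T_R)) → ∀ T : ℝ, 0 < T → ∀ D : ℕ → ℝ, (∀ N : ℕ, Filter.Tendsto (fun δ : ℝ => (Literature.MathematicalPhysics.KineticTheory.HeatConduction.pinnedChain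 ω₂ lam β γ).totalCurrent (μ N (T + δ / 2) (T - δ / 2)) / δ) (nhdsWithin 0 {(0 : ℝ)}ᶜ) (nhds (D N))) → (∀ N : ℕ, 2 ≤ N → 0 < D N) → ∃ C : ℝ, ∀ N M : ℕ, 2 ≤ N → 2 ≤ M → ((N : ℝ) - 1) / D N + ((M : ℝ) - 1) / D M - C ≤ ((N : ℝ) + (M : ℝ) - 1) / D (N + M) := by
  sorry

/-- **Stub 2 — NonBallistic (B): the conductance is not bounded away from zero (size L–XL; has a landed supplier
chain).** Under weak-NESS uniqueness, for every steady-state family, `T > 0` and response coefficients `D`: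
`∀ ε > 0 ∀ N₀ ∃ N ≥ N₀, D_N ≤ ε·(N−1)`. VERBATIM the shared item `NonBallistic` (stmt-AtomisticToContinuum-9127:
crux rank 3 of JunctionLocality, support of BondHeatUncertainty; `stub_nonBallistic_iff`). NECESSARY for the
conjunct and implied by the crux (a `liminf`, not a `sup`), so it cannot be too strong; in tree it is the OUTPUT of
the LANDED glue `Theorems.transferToNonBallistic_proof` (stmt-9656) fed by `LightConeBondHeat` (stmt-9123: √t
single-bond heat variance inside the sound cone `t ≤ aN` ⇒ `G_N ≤ c₁N^{−1/2} + c₂N^{−1/4} → 0`). Why it might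
fail: a hidden conserved quantity / near-integrable member would make the chain a perfect conductor (Mazur1969) —
then `FouriersLaw` is false too; proof-wise nothing gives `J_N → 0` for ANY deterministic anharmonic chain
(BonettoLebowitzReyBellet2000 §6.3). Role here: at `ε = 1/(|C|+1)` it supplies the ONE finite-size certificate
`R_{n₀} > C` that makes the superadditive sequence `R_N − C` grow linearly. -/
theorem Holds.stub_nonBallistic :
    ∀ ω₂ lam β γ : ℝ, 0 < ω₂ → 0 < lam → 0 < β → 0 < γ → (∀ (N : ℕ) (T_L T_R : ℝ), 0 < T_L → 0 < T_R → ∀ μ ν : MeasureTheory.Measure (Literature.MathematicalPhysics.KineticTheory.HeatConduction.PhaseSpace N), (Literature.MathematicalPhysics.KineticTheory.HeatConduction.pinnedChain ω₂ lam β γ).IsSteadyState N T_L T_R μ → (Literature.MathematicalPhysics.KineticTheory.HeatConduction.pinnedChain ω₂ lam β γ).IsSteadyState N T_L T_R ν → μ = ν) → ∀ μ : (N : ℕ) → ℝ → ℝ → MeasureTheory.Measure (Literature.MathematicalPhysics.KineticTheory.HeatConduction.PhaseSpace N), (∀ (N : ℕ) (T_L T_R : ℝ), 0 < T_L → 0 <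 T_R → (Literature.MathematicalPhysics.KineticTheory.HeatConduction.pinnedChain ω₂ lam β γ).IsSteadyState N T_L T_R (μ N T_L T_R)) → ∀ T : ℝ, 0 < T → ∀ D : ℕ → ℝ, (∀ N : ℕ, Filter.Tendsto (fun δ : ℝ => (Literature.MathematicalPhysics.KineticTheory.HeatConduction.pinnedChain ω₂ lam β γ).totalCurrent (μ N (T + δ / 2) (T - δ / 2)) / δ) (nhdsWithin 0 {(0 : ℝ)}ᶜ) (nhds (D N))) → ∀ ε : ℝ, 0 < ε → ∀ N₀ : ℕ, ∃ N : ℕ, N₀ ≤ N ∧ D N ≤ ε * ((N : ℝ) - 1) := by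
  sorry

/-! ### By-name handles of the two statements (no second copy of the text) -/

/-- Statement of registered stub 1 (`Holds.stub_superadditiveResistance`), by name. -/
def stub_superadditiveResistance : Prop := type_of% Holds.stub_superadditiveResistance

/-- Statement of registered stub 2 (`Holds.stub_nonBallistic`), by name. -/
def stub_nonBallistic : Prop := type_of% Holds.stub_nonBallistic

/-- Stub 1 IS the route item `JunctionLocality.SuperadditiveResistance` (stmt-AtomisticToContinuum-11748),
definitionally: a proof of either closes the other. [folklore] -/
theorem stub_superadditiveResistance_iff :
    stub_superadditiveResistance ↔
      Summit.AtomisticToContinuum.FouriersLaw.Theses.JunctionLocality.SuperadditiveResistance :=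
  Iff.rfl

/-- Stub 2 IS the shared route item `NonBallistic` (stmt-AtomisticToContinuum-9127; here by its JunctionLocality
name), definitionally. [folklore] -/
theorem stub_nonBallistic_iff :
    stub_nonBallistic ↔ Summit.AtomisticToContinuum.FouriersLaw.Theses.JunctionLocality.NonBallistic :=
  Iff.rfl

/-! ## Part III — the skeleton theorem: the two stubs give the crux BY NAME (sorry-free) -/

/-- **`BoundedResponse_of`** — `stub_superadditiveResistance → stub_nonBallistic → FeketeSeriesLaw.BoundedResponse`
(kernel-checked; axioms propext / Classical.choice / Quot.sound). Weak-NESS uniqueness is the LANDED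
`FeketeSeriesLaw.NessUnique_holds`, positivity `D_N > 0` (`N ≥ 2`) the LANDED
`TwoScaleGluingLogRigidity.Stubs.positiveConductance_holds`; the rest is `Glue.bddAbove_abs_of_superadditive_nonBallistic`.
[folklore] -/
theorem BoundedResponse_of (hA : stub_superadditiveResistance) (hB : stub_nonBallistic) :
    Summit.AtomisticToContinuum.FouriersLaw.Theses.FeketeSeriesLaw.BoundedResponse := by
  intro ω₂ lam β γ hω hl hβ hγ μ hμ T hT D hD
  have hU := Summit.AtomisticToContinuum.FouriersLaw.Theses.FeketeSeriesLaw.NessUnique_holds ω₂ lam β γ hω hl hβ hγ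
  have hP : ∀ N : ℕ, 2 ≤ N → 0 < D N :=
    Summit.AtomisticToContinuum.FouriersLaw.Cruxes.BoundedResponseConverges.TwoScaleGluingLogRigidity.Stubs.positiveConductance_holds
      ω₂ lam β γ hω hl hβ hγ hU μ hμ T hT D hD
  obtain ⟨C, hC⟩ := hA ω₂ lam β γ hω hl hβ hγ hU μ hμ T hT D hD hP
  exact Glue.bddAbove_abs_of_superadditive_nonBallistic hP hC (hB ω₂ lam β γ hω hl hβ hγ hU μ hμ T hT D hD)

/-- D-0027 §3.3 shape: the crux from the registered stubs (an `example`, so that `BoundedResponse_of` stays the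
unique theorem concluding the crux; it becomes a proof once the two `sorry`s are discharged). -/
example : Summit.AtomisticToContinuum.FouriersLaw.Theses.FeketeSeriesLaw.BoundedResponse :=
  BoundedResponse_of Holds.stub_superadditiveResistance Holds.stub_nonBallistic

end Summit.AtomisticToContinuum.FouriersLaw.Cruxes.BoundedResponse.Birth

end
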